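/-
Copyright (c) 2026 the pub-hodgecm-mathlib formalisation cell (harness21).  Prover seat hodgecm-mathlib-F0P2-p09 (g2), Track B «K2-LIT»,
#184♮ = hLiu418 = `stmt-HodgeConjecture-24832`; socket #41, KIND W ∕ KIND 1, brick (η) «THE GOOD-PLACE DISCHARGE PACKAGE» — LEAD F0P6-plan (g15) BATCH #194 (1);
KW desk F0P2-p08 (g3), K1b desk LH4-p14 (g8), box K2Liu-audit1 (g3).  THEOREMS ONLY (no `def`, no `instance`, no notation, no named-fact hypothesis, no `sorry`).
-/
import Summits.HodgeConjecture.HodgeConjecture.Theorems.K2LiuKindOneLineGoodPlaceLetters      -- ★ p863027 §1 `exists_finset_forall_valued_eq_one`, `_valuation_two_eq_one`, `_valued_imagUnit_eq_one`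
import Summits.HodgeConjecture.HodgeConjecture.Theorems.K2LiuKindWFiniteDualLatticeLetter      -- ★ p863721 (KW-fin-dual) `valued_entry_mul_le_of_unipDeltaChar_eq_one_on_ball`
import Literature.NumberTheory.Automorphic.GlobalAdditiveCharacterProofs                     -- ★ `eventually_hasConductorExp_zero_adicComponent_adeleAddChar`
import Literature.NumberTheory.Automorphic.GlobalAdditiveCharacter                           -- ★ `adeleAddCharAt_eq_adicComponent`
import Literature.NumberTheory.GaloisRepresentations.FrobeniusDensityTheorem                 -- ★ `finite_setOf_not_isUnramifiedIn`
import HarnessLib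

/-!
# Crux `HLiu418`, socket #41, brick (η): THE GOOD-PLACE DISCHARGE PACKAGE — ONE finite set of places of `L⁺` off which every DATUM-LEVEL local defect vanishes

Cell `hodgecm-mathlib`, crux item hLiu418 = `stmt-HodgeConjecture-24832` (helper lane `--supports … --as helper`, count-neutral), route of record `HCCMUnconditional`;
squad K2 ∕ K2Liu (L1), road `K2_Liu`, socket #41, KIND W ∕ KIND 1 (KW desk F0P2-p08 (g3), K1b desk LH4-p14 (g8)).  The per-place payers of the socket's by-value local letters
— (KW-fin-dual) ★ p863721 (`D`, `d_v`, `|2|_w`, `|δ|_w`, `e(w|v)`), (P-supp-lat) (lat-c) ED. 1″ of LH4-p18 (g3) (`D w`, `Bad`, `hD : ∀ w ∉ Bad, D w = 0`), the KW (iii-fin)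
size ∕ support letters of K2Liu-p26 ∕ K2E3-p03 (`Tβ`, `β`, `c`) — all carry DATUM-LEVEL DEFECTS that vanish at almost every place.  THIS FILE names ONE finite set
`Bad ⊂ {places of L⁺}` (and its pull-back `BadL ⊂ {places of L}`) off which, simultaneously: Tate's character `ψ_{L⁺,v} = adeleAddCharAt (Fp L) v` has conductor exponent `0`
(★ `eventually_hasConductorExp_zero_adicComponent_adeleAddChar`, [WeilBNT1967, Ch. IV §2 Cor. 1 of Th. 3]); `v` is unramified in `L`, so `e(w|v) = 1` for all `w ∣ v`
(★ `finite_setOf_not_isUnramifiedIn`: the ramified primes divide the different, [NeukirchANT1999, Ch. III §2 Thm. (2.6)]); `|2|_w = |δ|_w = 1` for all `w ∣ v` (★ p863027 §1,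
[CasselsFrohlichANT1967, Ch. XV (Tate) §3.1]: a non-zero element is a unit almost everywhere); and the diagonal Gram entries `g_k = gramR_{kk} ∈ L⁺ ∖ 0` are `v`-units (Mathlib
`HeightOneSpectrum.Support.finite`).  WHAT IS *NOT* HERE (honest): «`ψ_S = 1` on the integral ball» depends on the `v`-integrality of the index `S` (per-`S` cofinite, ★ (d1)
`exists_finset_forall_integral`) and «local factor `= 1`» is the per-`(S, h)` unramified computation — neither is datum-level.
* §1 `finite_setOf_valuation_ne_one` (`x ∈ L⁺ ∖ 0`), `exists_finset_forall_valued_algebraMap_eq_one`, `exists_finset_hasConductorExp_zero`, `exists_finset_isUnramifiedIn`.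
* §2 PACKAGE **`exists_goodPlaceFinset`** (indexed by `v`) and **`exists_goodPlaceFinset_over`** (indexed by `w`, `BadL := ⋃_{v ∈ Bad} PlacesOver L v`).
* §3 THE `D = 0` DISCHARGE of ★ p863721 at `n = 2`: **`exists_finset_valued_entry_le_of_unipDeltaChar_eq_one_on_ball`** — off `Bad`, `ψ_S ≡ 1` on `kindWLocalBall v π a` ⟹
  `|S_{a′b′}|_w ≤ exp(a)` at every `w ∣ v` (no defect, no conductor, `e = 1`).
HONEST LABEL.  Count-neutral helper; closes no socket by itself; `HC_CM` is proved only modulo the 7 printed citations (2 remaining named inputs: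
hLiu418 = `stmt-HodgeConjecture-24832`, h413 = `stmt-HodgeConjecture-24833`) until rung 0 closes.

## References
* [WeilBNT1967] A. Weil, *Basic Number Theory* (1967): Ch. IV §2, Cor. 1 of Th. 3 (local components of a global character are unramified almost everywhere).
* [NeukirchANT1999] J. Neukirch, *Algebraic Number Theory* (1999): Ch. III §2 Thm. (2.6) (the different and ramification).
* [CasselsFrohlichANT1967] Cassels–Fröhlich (eds.), *Algebraic Number Theory* (1967): Ch. XV (Tate) §3.1 (restricted products; units almost everywhere).
* [Shimura1997] G. Shimura, *Euler products and Eisenstein series*, CBMS 93 (1997): §18.4 Prop. 18.14.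
-/

set_option autoImplicit false
-- the mandated namespace repeats the single-problem summit's segment (`HodgeConjecture.HodgeConjecture`)
set_option linter.dupNamespace false

noncomputable section

open scoped Matrix NNReal WithZero ValuativeRel
open NumberField IsDedekindDomain Matrix
open Literature.NumberTheory.Automorphic Literature.NumberTheory.Automorphic.UnitaryGroup Literature.NumberTheory.GaloisRepresentations
open Literature.NumberTheory.GelbartRogawski1991 Literature.NumberTheory.GelbartRogawski1991.GRConstruction
open Literature.NumberTheory.GelbartRogawski1991.UnitaryDualPair
open Literature.NumberTheory.K2Lit Literature.NumberTheory.K2Lit.SiegelDoubled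
open Summit.HodgeConjecture.HodgeConjecture.Cruxes.HLiu418.K2LiuSiegelUnipotentLocalDefs
open Summit.HodgeConjecture.HodgeConjecture.Cruxes.HLiu418.K2LiuSiegelUnipotentFourierDefs
open Summit.HodgeConjecture.HodgeConjecture.Cruxes.HLiu418.K2LiuSiegelUnipotentCharacters
open Summit.HodgeConjecture.HodgeConjecture.Cruxes.HLiu418.K2LiuKindWFiniteLetterDefs
open Summit.HodgeConjecture.HodgeConjecture.Cruxes.HLiu418.K2LiuKindOneLineGoodPlaceLetters (exists_finset_forall_valued_eq_one exists_finset_forall_valuation_two_eq_one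
  exists_finset_forall_valued_imagUnit_eq_one)
open Summit.HodgeConjecture.HodgeConjecture.Cruxes.HLiu418.K2LiuKindWFiniteDualLatticeLetter (valued_entry_mul_le_of_unipDeltaChar_eq_one_on_ball)

namespace Summit.HodgeConjecture.HodgeConjecture.Cruxes.HLiu418.K2LiuFiniteGoodPlacePackage

variable (L : Type) [Field L] [NumberField L] [IsCMField L]

/-! ## §1 The four cofinite ingredients -/

omit [IsCMField L] in
/-- a non-zero `x ∈ L⁺` is a `v`-adic unit for all but finitely many `v` (Mathlib `HeightOneSpectrum.Support.finite` for `x` and `x⁻¹`). [cite: CasselsFrohlichANT1967, Ch. XV (Tate) §3.1] -/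
theorem finite_setOf_valuation_ne_one {x : Fp L} (hx : x ≠ 0) : {v : HeightOneSpectrum (𝓞 (Fp L)) | v.valuation (Fp L) x ≠ 1}.Finite := by
  refine ((HeightOneSpectrum.Support.finite (𝓞 (Fp L)) x).union (HeightOneSpectrum.Support.finite (𝓞 (Fp L)) x⁻¹)).subset fun v hv => ?_
  simp only [Set.mem_setOf_eq, Set.mem_union, HeightOneSpectrum.Support, map_inv₀] at hv ⊢
  rcases hv.lt_or_gt with h | h
  · exact Or.inr ((one_lt_inv₀ ((Valuation.pos_iff _).mpr hx)).mpr h)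
  · exact Or.inl h

omit [IsCMField L] in
/-- `Finset` form in the completion: off a finite set of places, `|x|_v = 1` in `L⁺_v` (Mathlib `valuedAdicCompletion_eq_valuation'`). [cite: CasselsFrohlichANT1967, Ch. XV (Tate) §3.1] -/
theorem exists_finset_forall_valued_algebraMap_eq_one {x : Fp L} (hx : x ≠ 0) :
    ∃ T : Finset (HeightOneSpectrum (𝓞 (Fp L))), ∀ v, v ∉ T → Valued.v (algebraMap (Fp L) (v.adicCompletion (Fp L)) x) = 1 := by
  refine ⟨(finite_setOf_valuation_ne_one L hx).toFinset, fun v hv => ?_⟩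
  rw [Set.Finite.mem_toFinset, Set.mem_setOf_eq, not_not] at hv
  rw [HeightOneSpectrum.algebraMap_adicCompletion, Function.comp_apply, Algebra.algebraMap_self, RingHom.id_apply,
    HeightOneSpectrum.valuedAdicCompletion_eq_valuation']
  exact hv

omit [IsCMField L] in
/-- **TATE'S CHARACTER IS UNRAMIFIED ALMOST EVERYWHERE**: off a finite set of places of `L⁺`, `ψ_{L⁺,v} = adeleAddCharAt (Fp L) v` has conductor exponent `0`
(★ `eventually_hasConductorExp_zero_adicComponent_adeleAddChar`, ★ `adeleAddCharAt_eq_adicComponent`). [cite: WeilBNT1967, Ch. IV §2, Cor. 1 of Th. 3] -/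
theorem exists_finset_hasConductorExp_zero :
    ∃ T : Finset (HeightOneSpectrum (𝓞 (Fp L))), ∀ v, v ∉ T → (adeleAddCharAt (Fp L) v).HasConductorExp 0 := by
  have h := eventually_hasConductorExp_zero_adicComponent_adeleAddChar (K := Fp L)
  rw [Filter.eventually_cofinite] at h
  refine ⟨h.toFinset, fun v hv => ?_⟩
  rw [adeleAddCharAt_eq_adicComponent]
  by_contra hc
  exact hv (h.mem_toFinset.2 hc)

omit [IsCMField L] in
/-- **ONLY FINITELY MANY PLACES OF `L⁺` RAMIFY IN `L`** (★ `finite_setOf_not_isUnramifiedIn`), `Finset` form. [cite: NeukirchANT1999, Ch. III §2 Thm. (2.6)] -/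
theorem exists_finset_isUnramifiedIn :
    ∃ T : Finset (HeightOneSpectrum (𝓞 (Fp L))), ∀ v, v ∉ T → Algebra.IsUnramifiedIn (𝓞 L) v.asIdeal := by
  refine ⟨(Literature.NumberTheory.GaloisRepresentations.finite_setOf_not_isUnramifiedIn (Fp L) L).toFinset, fun v hv => ?_⟩
  by_contra hc
  exact hv ((Set.Finite.mem_toFinset _).2 hc)

/-! ## §2 The package -/

section Package

variable {N M n : ℕ} (e : Fin N × Fin M ≃ Fin n)
  (dV : Fin N → L) (hdV : ∀ i, IsCMField.complexConj L (dV i) = dV i)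
  (dW : Fin M → L) (hdW : ∀ i, IsCMField.complexConj L (dW i) = dW i)

/-- **(η) THE GOOD-PLACE FINITE SET OF THE DATUM.**  For the KW frame `(L, e, dV, dW)` with non-zero diagonal Gram entries `g_k = gramR_{kk}` (★ `gramR_apply_same_ne_zero`), there is ONE
finite set `Bad` of finite places of `L⁺` such that at every `v ∉ Bad`: (1) `ψ_{L⁺,v}` has conductor exponent `0`; (2) `v` is unramified in `L`, (3) so `e(w|v) = 1` for every
`w ∣ v`; (4) `|2|_w = 1` (both spellings) and (5) `|δ|_w = 1` (`δ = imagUnit L`) for every `w ∣ v`; (6) every `g_k` is a `v`-unit, `|g_k|_v = 1`.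
[cite: WeilBNT1967, Ch. IV §2, Cor. 1 of Th. 3] [cite: NeukirchANT1999, Ch. III §2 Thm. (2.6)] [cite: CasselsFrohlichANT1967, Ch. XV (Tate) §3.1] -/
theorem exists_goodPlaceFinset (hg : ∀ k : Fin n, gramR L e dV hdV dW hdW k k ≠ 0) :
    ∃ Bad : Finset (HeightOneSpectrum (𝓞 (Fp L))), ∀ v, v ∉ Bad →
      (adeleAddCharAt (Fp L) v).HasConductorExp 0 ∧
      Algebra.IsUnramifiedIn (𝓞 L) v.asIdeal ∧
      (∀ w : UnitaryGroup.PlacesOver L v, v.asIdeal.ramificationIdx' w.1.asIdeal = 1) ∧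
      (∀ w : UnitaryGroup.PlacesOver L v, Valued.v ((2 : L) : w.1.adicCompletion L) = 1) ∧
      (∀ w : UnitaryGroup.PlacesOver L v, ValuativeRel.valuation (w.1.adicCompletion L) (2 : w.1.adicCompletion L) = 1) ∧
      (∀ w : UnitaryGroup.PlacesOver L v, Valued.v ((imagUnit L : L) : w.1.adicCompletion L) = 1) ∧
      (∀ k : Fin n, Valued.v (algebraMap (Fp L) (v.adicCompletion (Fp L)) (gramR L e dV hdV dW hdW k k)) = 1) := by
  classical
  obtain ⟨Tψ, hTψ⟩ := exists_finset_hasConductorExp_zero L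
  obtain ⟨Tu, hTu⟩ := exists_finset_isUnramifiedIn L
  obtain ⟨T₂, hT₂⟩ := exists_finset_forall_valued_eq_one L (x := (2 : L)) two_ne_zero
  obtain ⟨T₂', hT₂'⟩ := exists_finset_forall_valuation_two_eq_one L
  obtain ⟨Tδ, hTδ⟩ := exists_finset_forall_valued_imagUnit_eq_one L
  choose Tg hTg using fun k : Fin n => exists_finset_forall_valued_algebraMap_eq_one L (hg k)
  refine ⟨Tψ ∪ Tu ∪ T₂ ∪ T₂' ∪ Tδ ∪ Finset.univ.biUnion Tg, fun v hv => ?_⟩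
  simp only [Finset.mem_union, Finset.mem_biUnion, Finset.mem_univ, true_and, not_or, not_exists] at hv
  obtain ⟨⟨⟨⟨⟨hvψ, hvu⟩, hv₂⟩, hv₂'⟩, hvδ⟩, hvg⟩ := hv
  have h2 : ∀ w : UnitaryGroup.PlacesOver L v, Valued.v ((2 : L) : w.1.adicCompletion L) = 1 := fun w => by
    have h := hT₂ v hv₂ w
    rwa [map_ofNat] at h ⊢
  exact ⟨hTψ v hvψ, hTu v hvu,
    fun w => Literature.NumberTheory.Automorphic.Liu2021.LemD1IndexedNonVacuityInertCofinite.ramificationIdx'_eq_one_of_isUnramifiedIn L v (hTu v hvu) w,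
    h2, hT₂' v hv₂', hTδ v hvδ, fun k => hTg k v (hvg k)⟩

/-- **THE SAME PACKAGE INDEXED BY THE PLACES OF `L`** (`BadL := ⋃_{v ∈ Bad} {w ∣ v}` — the `Tβ` ∕ `(Bad, hD)` currency of the KW (iii-fin) letters and of (lat-c) ED. 1″): for every
`v` and every `w ∣ v` with `w ∉ BadL`, the six letters of `exists_goodPlaceFinset` hold at `v`. [cite: WeilBNT1967, Ch. IV §2, Cor. 1 of Th. 3] [cite: CasselsFrohlichANT1967, Ch. XV (Tate) §3.1] -/
theorem exists_goodPlaceFinset_over (hg : ∀ k : Fin n, gramR L e dV hdV dW hdW k k ≠ 0) :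
    ∃ BadL : Finset (HeightOneSpectrum (𝓞 L)), ∀ (v : HeightOneSpectrum (𝓞 (Fp L))) (w₀ : UnitaryGroup.PlacesOver L v), w₀.1 ∉ BadL →
      (adeleAddCharAt (Fp L) v).HasConductorExp 0 ∧
      Algebra.IsUnramifiedIn (𝓞 L) v.asIdeal ∧
      (∀ w : UnitaryGroup.PlacesOver L v, v.asIdeal.ramificationIdx' w.1.asIdeal = 1) ∧
      (∀ w : UnitaryGroup.PlacesOver L v, Valued.v ((2 : L) : w.1.adicCompletion L) = 1) ∧
      (∀ w : UnitaryGroup.PlacesOver L v, ValuativeRel.valuation (w.1.adicCompletion L) (2 : w.1.adicCompletion L) = 1) ∧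
      (∀ w : UnitaryGroup.PlacesOver L v, Valued.v ((imagUnit L : L) : w.1.adicCompletion L) = 1) ∧
      (∀ k : Fin n, Valued.v (algebraMap (Fp L) (v.adicCompletion (Fp L)) (gramR L e dV hdV dW hdW k k)) = 1) := by
  classical
  obtain ⟨Bad, hBad⟩ := exists_goodPlaceFinset L e dV hdV dW hdW hg
  refine ⟨Bad.biUnion fun v => Finset.univ.image fun w : UnitaryGroup.PlacesOver L v => w.1, fun v w₀ hw₀ => hBad v fun hv => hw₀ ?_⟩
  exact Finset.mem_biUnion.2 ⟨v, hv, Finset.mem_image.2 ⟨w₀, Finset.mem_univ _, rfl⟩⟩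

end Package

/-! ## §3 The `D = 0` discharge of ★ (KW-fin-dual) at `n = 2` -/

section Two

variable {N M : ℕ} (e : Fin N × Fin M ≃ Fin 2)
  (dV : Fin N → L) (hdV : ∀ i, IsCMField.complexConj L (dV i) = dV i)
  (dW : Fin M → L) (hdW : ∀ i, IsCMField.complexConj L (dW i) = dW i)

/-- **(KW-fin-dual) AT A GOOD PLACE, BY ONE NAME.**  Off the finite set `Bad` of `exists_goodPlaceFinset`: for every uniformiser `π` of `L⁺_v`, every Fourier index
`S ∈ Skew_{gramR ⊗ L}(L)` and every ball exponent `a ∈ ℤ`, IF `ψ_S(ι_v u₀) = 1` for all `u₀ ∈ kindWLocalBall v π a` THEN **`|S_{a′b′}|_w ≤ exp(a)`** at every `w ∣ v`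
(★ p863721 with `D = 0`, `d = 0`, `|2|_w = |δ|_w = 1`, `e(w|v) = 1`). [cite: Shimura1997, §18.4 Prop. 18.14] [cite: WeilBNT1967, Ch. IV §2, Cor. 1 of Th. 3] -/
theorem exists_finset_valued_entry_le_of_unipDeltaChar_eq_one_on_ball (hg : ∀ k : Fin 2, gramR L e dV hdV dW hdW k k ≠ 0) :
    ∃ Bad : Finset (HeightOneSpectrum (𝓞 (Fp L))), ∀ v, v ∉ Bad →
      ∀ {π : v.adicCompletion (Fp L)} (_ : Valued.v π = WithZero.exp (-1 : ℤ)) (S : Matrix (Fin 2) (Fin 2) L)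
        (_ : S ∈ skewMatrices ((IsCMField.complexConj L : L ≃ₐ[Fp L] L) : L →+* L) ((gramR L e dV hdV dW hdW).map (algebraMap (Fp L) L))) (a : ℤ),
        (∀ u₀ : ↥(unipDeltaLoc L e dV hdV dW hdW v), u₀ ∈ kindWLocalBall L e dV hdV dW hdW v π a →
          unipDeltaChar L e dV hdV dW hdW S (locToAdelic L e dV hdV dW hdW v
            (u₀ : UnitaryGroup.localPi L (IsCMField.complexConj L) (2 + 2) (hermD L e dV hdV dW hdW) v)) = 1) →
        ∀ (w : UnitaryGroup.PlacesOver L v) (a' b' : Fin 2), Valued.v ((S a' b' : L) : w.1.adicCompletion L) ≤ WithZero.exp a := by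
  obtain ⟨Bad, hBad⟩ := exists_goodPlaceFinset L e dV hdV dW hdW hg
  refine ⟨Bad, fun v hv π hπ S hS a h1 w a' b' => ?_⟩
  obtain ⟨hψ, -, he, h2, -, hδ, hgv⟩ := hBad v hv
  have hDg : Valued.v (algebraMap (Fp L) (v.adicCompletion (Fp L)) (gramR L e dV hdV dW hdW 0 0) *
        (algebraMap (Fp L) (v.adicCompletion (Fp L)) (gramR L e dV hdV dW hdW 1 1))⁻¹) ≤ WithZero.exp ((0 : ℕ) : ℤ) ∧
      Valued.v (algebraMap (Fp L) (v.adicCompletion (Fp L)) (gramR L e dV hdV dW hdW 1 1) *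
        (algebraMap (Fp L) (v.adicCompletion (Fp L)) (gramR L e dV hdV dW hdW 0 0))⁻¹) ≤ WithZero.exp ((0 : ℕ) : ℤ) := by
    rw [Valuation.map_mul, Valuation.map_mul, map_inv₀, map_inv₀, hgv 0, hgv 1, inv_one, mul_one, Nat.cast_zero, WithZero.exp_zero]
    exact ⟨le_rfl, le_rfl⟩
  have hDδ : ∀ w' : UnitaryGroup.PlacesOver L v,
      Valued.v ((imagUnit L : L) : w'.1.adicCompletion L) ≤ WithZero.exp ((v.asIdeal.ramificationIdx' w'.1.asIdeal : ℤ) * ((0 : ℕ) : ℤ)) := fun w' => by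
    rw [hδ w', Nat.cast_zero, mul_zero, WithZero.exp_zero]
  have h := valued_entry_mul_le_of_unipDeltaChar_eq_one_on_ball L e dV hdV dW hdW v hπ hψ hg 0 hDg hDδ S hS a h1 w a' b'
  rwa [h2 w, hδ w, one_mul, one_mul, max_self, one_mul, he w, Nat.cast_one, one_mul, Nat.cast_zero, mul_zero, add_zero, sub_zero] at h

end Two

end Summit.HodgeConjecture.HodgeConjecture.Cruxes.HLiu418.K2LiuFiniteGoodPlacePackage

end
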